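import Literature.Analysis.InnerProduct.LensSpaceGeneratingFunction
import Mathlib.Analysis.SpecialFunctions.Trigonometric.Cotangent
import HarnessLib

/-!
# The residues of the generating function of a three-dimensional lens space `L(q; 1, p)` at its simple poles, and the
# eight-term cotangent relation between two isospectral lens spaces (Ikeda–Yamamoto 1979 §4: Proposition 4.6, Corollary 4.7)

Layer `Literature/Analysis/InnerProduct`, namespace `Literature.Analysis.InnerProduct`; lane `lit-hodgefound`, prover seat
`lit-hodgefound-p06`, generation 45, row g45-#1. THEOREMS only (no definition, no instance, no notation, no named fact). This is
§4 of the source — the step between Theorem 3.2 (the generating function `F(z) = ∑_k dim E_{k(k+2)} z^k` of `L(q; 1, p)` in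
closed form, the tree's `hasSum_lensMultiplicity_mul_pow`) and the Main Theorem (two isospectral three-dimensional lens spaces
are isometric, §6–§9): the residue of `F` at a `q`-th root of unity where `F` has a SIMPLE pole, and the resulting linear
relation (4.18) between eight cotangent values for two isospectral lens spaces `L(q; 1, p₁)`, `L(q; 1, p₂)`. The companion
`LensSpaceIsospectralRigidityPrime.lean` (row g45-#2) feeds (4.18) into the tree's theorem of Chowla–Okada (= the source's Key
Lemma 5.3) and proves the Main Theorem for `q` an odd prime.

## Source, verbatim (held text `paper:doi-10-18910-4811`)

A. Ikeda, Y. Yamamoto, *On the spectra of 3-dimensional lens spaces*, Osaka J. Math. **16** (1979) 447–469. §4 (p. 453–457):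
"Hereafter in this paper, we consider only 3-dimensional lens spaces. Let `L(q : p₀, p₁)` be a lens space. Choosing a suitable
generator for its defining cyclic group `G`, we may assume `p₀ = 1`. From now on, a lens space `L(q : 1, p)` is simply denoted
by `L(q : p)`. … **Lemma 4.2.** Let `q` be a positive integer `≥ 2` and `p` an integer prime to `q`. Choose an integer `p*`
satisfying `pp* ≡ 1 (mod q)`. … **Corollary 4.5.** Let `L(q : p₁)` and `L(q : p₂)` be as in Lemma 4.4. Let `k` be an integer
such that (4.13) `(p₁ + 1)k ≢ 0 (mod q)` and (4.14) `(p₁ − 1)k ≢ 0 (mod q)`. Then we have (4.15) `(p₂ + 1)k ≢ 0 (mod q)` and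
(4.16) `(p₂ − 1)k ≢ 0 (mod q)`. **Proposition 4.6.** Let `L(q : p₁)` and `L(q : p₂)` be as in Lemma 4.4. Then for any integer `k`
satisfying (4.13) and (4.14), we have (4.17) [the equality of the residues of the two generating functions at `γ^k`]. Proof. Let
`k` be an integer satisfying (4.13) and (4.14). Then by multiplying (4.13) and (4.14) by `p₁*`, we have `(p₁* + 1)k ≢ 0 (mod q)`
and `(p₁* − 1)k ≢ 0 (mod q)`. We calculate the residue of `F₁(z)` at `z = γ^k`. `lim_{z→γ^k}(z − γ^k)F₁(z) = ⋯`. Since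
`F₁(z) = F₂(z)`, we have the similar result for `F₂(z)`. Now, we obtain (4.17). q.e.d. **Corollary 4.7.** Let `L(q : p₁)`,
`L(q : p₂)` and `k` be as in Corollary 4.5. Then we have
(4.18) `cot(π/q)(p₁+1)k − cot(π/q)(p₁−1)k + cot(π/q)(p₁*+1)k − cot(π/q)(p₁*−1)k`
`− cot(π/q)(p₂+1)k + cot(π/q)(p₂−1)k − cot(π/q)(p₂*+1)k + cot(π/q)(p₂*−1)k = 0`.
Proof. Using an elementary formula; [`cot α cot β = cot(α − β)(cot β − cot α) − 1`] we can obtain easily (4.18) from (4.17).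
q.e.d." Here `γ = e^{2π√−1/q}` and (Theorem 3.2, (3.8), `n + 1 = 2`)
`F(z) = (1/q)∑_{l=0}^{q−1}(1 − z²)/((1 − γ^{l}z)(1 − γ^{−l}z)(1 − γ^{lp}z)(1 − γ^{−lp}z))`.

## The computation, as formalised (`e(t) = e^{2πit/q}`, `z₀ = e(−k) = γ̄^k`; the pole at `γ^k` of the source is treated at
## the conjugate root `γ^{−k}`, which is the same computation with `k ↦ −k` — all hypotheses and (4.18) are invariant)

Fix `p` with `pp* ≡ 1 (mod q)` (`p* = u`) and an integer `k` with `q ∤ 2k`, `q ∤ k(p−1)`, `q ∤ k(p+1)` ((4.13)–(4.14); for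
odd `q` the first condition is `q ∤ k`). A factor `1 − e(t)z` of the `l`-th term of (3.8) (`t ∈ {l, −l, lp, −lp}`) vanishes
at `z₀ = e(−k)` iff `t ≡ k (mod q)`, i.e. iff `l ≡ k`, `l ≡ −k`, `l ≡ kp*` or `l ≡ −kp*` respectively; under the three
non-congruences these four classes are pairwise distinct, so exactly four terms have exactly ONE vanishing factor and all other
terms are holomorphic at `z₀`. The terms `l ≡ ±k` coincide, as functions of `z`, with
`T(z) = (1 − z²)/((1 − e(k)z)(1 − e(−k)z)(1 − e(kp)z)(1 − e(−kp)z))`, and `(1 − e(k)z)T(z) → (1 − e(−2k))/((1 − e(−2k))(1 −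
e(k(p−1)))(1 − e(−k(p+1)))) = R(p)`, `R(p) := 1/((1 − e(k(p−1)))(1 − e(−k(p+1))))`; the terms `l ≡ ±kp*` coincide with the
same expression for the weight `p*` (`{e(±kp*), e(±kp*p)} = {e(±kp*), e(±k)}`), limit `R(p*)`. Hence (PROPOSITION 4.6)
`(1 − e(k)z)·F(z) → (2/q)(R(p) + R(p*))` as `z → e(−k)`, and the limit transfers to the power series `∑_n dim E_{n(n+2)}z^n`
along `z → z₀` inside the unit disc (`z₀` is in the closure of the disc of convergence). Two isospectral spaces have the same
power series, so (4.17) `R(p₁) + R(p₁*) = R(p₂) + R(p₂*)`. For COROLLARY 4.7 put `c(t) = (1 + e(t))/(1 − e(t)) = i·cot(πt/q)`: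
`1/(1 − e(t)) = (1 + c(t))/2`, `1/(1 − e(−t)) = (1 − c(t))/2`, and the "elementary formula" is `c(A)c(B) = 1 − c(A−B)(c(A) −
c(B))`; with `A = k(p+1)`, `B = k(p−1)`, `A − B = 2k` this gives `R(p) = (c(k(p+1)) − c(k(p−1)))(c(2k) − 1)/4`, and since
`c(2k) ≠ 1` the common factor cancels from (4.17):
`c(k(p₁+1)) − c(k(p₁−1)) + c(k(p₁*+1)) − c(k(p₁*−1)) = c(k(p₂+1)) − c(k(p₂−1)) + c(k(p₂*+1)) − c(k(p₂*−1))`, which after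
division by `i` is (4.18) verbatim.

## What is proved

* §1 (private): the arithmetic of `e(t)`: `e(a)e(b) = e(a+b)`, `e(a) = e(b) ↔ a ≡ b`, `e(a) = 1 ↔ q ∣ a`, `|e(a)| = 1`, the
  passage between the tree's shape `e^{2πi·l·p/q}` of (3.8) and `e(lp)`; the two limit lemmas (no vanishing factor / exactly one
  vanishing factor); the distinctness of the four classes `±k, ±kp*` in `ℤ/q`.
* §2 (private): the five cases of the `l`-th term and their assembly over `l ∈ ℤ/q`.
* §3: **`tendsto_one_sub_exp_mul_tsum_lensMultiplicity`** (PROPOSITION 4.6: `(1 − e(k)z)∑_n dim E_{n(n+2)}(L(q;1,p))z^n →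
  (2/q)(R(p) + R(p*))` as `z → e(−k)` in the disc), **`residue_eq_of_lensMultiplicity_eq`** ((4.17)).
* §4: **`I_mul_cot_eq_ratio`** (`i cot(πt/q) = c(t)`), **`ratio_mul_ratio`** (the elementary formula), **`residue_eq_ratio`**
  (`R(p) = (c(k(p+1)) − c(k(p−1)))(c(2k) − 1)/4`), **`ratio_alternatingSum_eq_of_lensMultiplicity_eq`** ((4.18) in the `c`-form),
  **`cot_alternatingSum_eq_of_lensMultiplicity_eq`** (COROLLARY 4.7, (4.18) as printed).

## References

* [IkedaYamamoto1979] A. Ikeda, Y. Yamamoto, *On the spectra of 3-dimensional lens spaces*, Osaka J. Math. 16 (1979) 447–469,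
  §4: Lemma 4.2, Corollary 4.5, Proposition 4.6, Corollary 4.7, with Theorem 3.2 (3.8) and Proposition 3.1.
-/

noncomputable section

open Finset Filter Topology Complex

namespace Literature.Analysis.InnerProduct

open _root_.Real _root_.Filter _root_.Topology

/-! ### §1 The roots of unity `e(t) = e^{2πit/q}`, the two limit lemmas, the four special classes -/

/-- `e(a)·e(b) = e(a + b)`. [folklore] -/
private theorem exp_intCast_mul_exp_intCast (q : ℕ) (a b : ℤ) :
    cexp (2 * π * I * a / q) * cexp (2 * π * I * b / q) = cexp (2 * π * I * ((a + b : ℤ) : ℂ) / q) := by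
  rw [← Complex.exp_add]
  congr 1
  push_cast
  ring

/-- `e(a) = 1 ↔ q ∣ a`. [folklore] -/
private theorem exp_intCast_eq_one_iff {q : ℕ} (hq : q ≠ 0) (a : ℤ) :
    cexp (2 * π * I * a / q) = 1 ↔ (q : ℤ) ∣ a := by
  have hq0 : (q : ℂ) ≠ 0 := Nat.cast_ne_zero.mpr hq
  have h2 : (2 * π * I : ℂ) ≠ 0 := by simp [Real.pi_ne_zero, I_ne_zero]
  constructor
  · intro h
    obtain ⟨n, hn⟩ := Complex.exp_eq_one_iff.mp h
    have h3 := congrArg (· * (q : ℂ)) hn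
    simp only [div_mul_cancel₀ _ hq0] at h3
    have h4 : (2 * π * I) * (a : ℂ) = (2 * π * I) * (n * q) := by linear_combination h3
    have h5 := mul_left_cancel₀ h2 h4
    exact ⟨n, by exact_mod_cast h5.trans (mul_comm _ _)⟩
  · rintro ⟨c, hc⟩
    rw [hc, show (2 * π * I * ((q * c : ℤ) : ℂ) / q) = c * (2 * π * I) by push_cast; field_simp]
    exact Complex.exp_int_mul_two_pi_mul_I c

/-- `e(a) = 1 ↔ a ≡ 0` in `ℤ/q`. [folklore] -/
private theorem exp_intCast_eq_one_iff_cast {q : ℕ} (hq : q ≠ 0) (a : ℤ) :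
    cexp (2 * π * I * a / q) = 1 ↔ (a : ZMod q) = 0 := by
  rw [exp_intCast_eq_one_iff hq, ZMod.intCast_zmod_eq_zero_iff_dvd]

/-- `e(a) = e(b) ↔ a ≡ b` in `ℤ/q`. [folklore] -/
private theorem exp_intCast_eq_iff {q : ℕ} (hq : q ≠ 0) (a b : ℤ) :
    cexp (2 * π * I * a / q) = cexp (2 * π * I * b / q) ↔ (a : ZMod q) = (b : ZMod q) := by
  have hb : cexp (2 * π * I * b / q) ≠ 0 := Complex.exp_ne_zero _
  rw [← div_eq_one_iff_eq hb, ← Complex.exp_sub, show 2 * π * I * (a : ℂ) / q - 2 * π * I * (b : ℂ) / q =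
    2 * π * I * ((a - b : ℤ) : ℂ) / q by push_cast; ring, exp_intCast_eq_one_iff_cast hq, Int.cast_sub, sub_eq_zero]

/-- `e(a) = e(b)` when `a ≡ b` in `ℤ/q`. [folklore] -/
private theorem exp_intCast_congr {q : ℕ} (hq : q ≠ 0) {a b : ℤ} (h : (a : ZMod q) = (b : ZMod q)) :
    cexp (2 * π * I * a / q) = cexp (2 * π * I * b / q) :=
  (exp_intCast_eq_iff hq a b).mpr h

/-- `|e(a)| = 1`. [folklore] -/
private theorem norm_exp_intCast (q : ℕ) (a : ℤ) : ‖cexp (2 * π * I * a / q)‖ = 1 := by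
  rw [show (2 * π * I * a / q : ℂ) = ((2 * π * a / q : ℝ) : ℂ) * I by push_cast; ring]
  exact Complex.norm_exp_ofReal_mul_I _

/-- The tree's `e^{2πi·l·p/q}` of (3.8) is `e(lp)`. [folklore] -/
private theorem exp_natCast_mul_intCast (q l : ℕ) (p : ℤ) :
    cexp (2 * π * I * l * p / q) = cexp (2 * π * I * (((l : ℤ) * p : ℤ) : ℂ) / q) := by
  congr 1
  push_cast
  ring

/-- The tree's `e^{−2πi·l·p/q}` of (3.8) is `e(−lp)`. [folklore] -/
private theorem exp_neg_natCast_mul_intCast (q l : ℕ) (p : ℤ) :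
    cexp (-(2 * π * I * l * p / q)) = cexp (2 * π * I * ((-((l : ℤ) * p) : ℤ) : ℂ) / q) := by
  congr 1
  push_cast
  ring

/-- **No factor vanishes at `z₀`** (a term holomorphic at `z₀`): `(1 − γz)·(1 − z²)/D(z) → 0` as `z → z₀` when `γz₀ = 1`, `D`
is continuous at `z₀` and `D(z₀) ≠ 0`. [folklore] -/
private theorem tendsto_mul_div_of_ne_zero {γ z₀ : ℂ} (hγ : γ * z₀ = 1) {D : ℂ → ℂ} (hD : ContinuousAt D z₀)
    (hD0 : D z₀ ≠ 0) :
    Tendsto (fun z : ℂ ↦ (1 - γ * z) * ((1 - z ^ 2) / D z)) (𝓝[≠] z₀) (𝓝 0) := by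
  have h1 : Tendsto (fun z : ℂ ↦ 1 - γ * z) (𝓝 z₀) (𝓝 (1 - γ * z₀)) :=
    tendsto_const_nhds.sub (tendsto_const_nhds.mul tendsto_id)
  rw [hγ, sub_self] at h1
  have h2 : Tendsto (fun z : ℂ ↦ (1 - z ^ 2) / D z) (𝓝 z₀) (𝓝 ((1 - z₀ ^ 2) / D z₀)) :=
    (tendsto_const_nhds.sub (tendsto_id.pow 2)).div hD.tendsto hD0
  have h3 := h1.mul h2
  rw [zero_mul] at h3
  exact h3.mono_left nhdsWithin_le_nhds

/-- `γz₀ = 1`, `z ≠ z₀ ⇒ 1 − γz ≠ 0`. [folklore] -/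
private theorem one_sub_mul_ne_zero_of_ne {γ z₀ z : ℂ} (hγ : γ * z₀ = 1) (hz : z ≠ z₀) : 1 - γ * z ≠ 0 := by
  intro h
  apply hz
  have hγ0 : γ ≠ 0 := by
    rintro rfl
    simp at hγ
  exact mul_left_cancel₀ hγ0 ((sub_eq_zero.mp h).symm.trans hγ.symm)

/-- **Exactly one factor vanishes at `z₀`** (a simple pole of the term): if `D(z) = (1 − γz)R(z)` with `γz₀ = 1`, `R` continuous
at `z₀` and `R(z₀) ≠ 0`, then `(1 − γz)·(1 − z²)/D(z) → (1 − z₀²)/R(z₀)` as `z → z₀`, `z ≠ z₀`. [folklore] -/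
private theorem tendsto_mul_div_of_factor {γ z₀ : ℂ} (hγ : γ * z₀ = 1) {D R : ℂ → ℂ}
    (hDR : ∀ z, D z = (1 - γ * z) * R z) (hR : ContinuousAt R z₀) (hR0 : R z₀ ≠ 0) :
    Tendsto (fun z : ℂ ↦ (1 - γ * z) * ((1 - z ^ 2) / D z)) (𝓝[≠] z₀) (𝓝 ((1 - z₀ ^ 2) / R z₀)) := by
  have h2 : Tendsto (fun z : ℂ ↦ (1 - z ^ 2) / R z) (𝓝 z₀) (𝓝 ((1 - z₀ ^ 2) / R z₀)) :=
    (tendsto_const_nhds.sub (tendsto_id.pow 2)).div hR.tendsto hR0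
  refine (h2.mono_left nhdsWithin_le_nhds).congr' ?_
  filter_upwards [self_mem_nhdsWithin, mem_nhdsWithin_of_mem_nhds (hR.eventually_ne hR0)] with z hz hRz
  have hz' := one_sub_mul_ne_zero_of_ne hγ hz
  have hz'' : 1 - z * γ ≠ 0 := by rwa [mul_comm] at hz'
  rw [hDR z]
  field_simp

/-- **The term with its vanishing factor in front** (`l ≡ ±k` for the weight `p`, `l ≡ ±kp*` read as the weight `p*`): for
`q ∤ 2k`, `q ∤ k(p−1)`, `q ∤ k(p+1)`,
`(1 − e(k)z)·(1 − z²)/((1 − e(k)z)(1 − e(−k)z)(1 − e(kp)z)(1 − e(−kp)z)) → 1/((1 − e(k(p−1)))(1 − e(−k(p+1))))` as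
`z → e(−k)`. [cite: IkedaYamamoto1979, proof of Proposition 4.6] -/
private theorem tendsto_core {q : ℕ} (hq : q ≠ 0) {k p : ℤ} (h2 : ¬ (q : ℤ) ∣ 2 * k) (hm : ¬ (q : ℤ) ∣ k * (p - 1))
    (hp : ¬ (q : ℤ) ∣ k * (p + 1)) :
    Tendsto (fun z : ℂ ↦ (1 - cexp (2 * π * I * k / q) * z) * ((1 - z ^ 2) /
      ((1 - cexp (2 * π * I * k / q) * z) * (1 - cexp (2 * π * I * ((-k : ℤ) : ℂ) / q) * z) *
        ((1 - cexp (2 * π * I * ((k * p : ℤ) : ℂ) / q) * z) * (1 - cexp (2 * π * I * ((-(k * p) : ℤ) : ℂ) / q) * z)))))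
      (𝓝[≠] (cexp (2 * π * I * ((-k : ℤ) : ℂ) / q)))
      (𝓝 (1 / ((1 - cexp (2 * π * I * ((k * (p - 1) : ℤ) : ℂ) / q)) *
        (1 - cexp (2 * π * I * ((-(k * (p + 1)) : ℤ) : ℂ) / q))))) := by
  -- the values at `z₀ = e(−k)`
  have hγ : cexp (2 * π * I * k / q) * cexp (2 * π * I * ((-k : ℤ) : ℂ) / q) = 1 := by
    rw [exp_intCast_mul_exp_intCast, show k + -k = 0 by ring, Int.cast_zero, mul_zero, zero_div, Complex.exp_zero]
  have hsq : cexp (2 * π * I * ((-k : ℤ) : ℂ) / q) ^ 2 = cexp (2 * π * I * ((-(2 * k) : ℤ) : ℂ) / q) := by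
    rw [sq, exp_intCast_mul_exp_intCast, show -k + -k = -(2 * k) by ring]
  have hv1 : cexp (2 * π * I * ((-k : ℤ) : ℂ) / q) * cexp (2 * π * I * ((-k : ℤ) : ℂ) / q) =
      cexp (2 * π * I * ((-(2 * k) : ℤ) : ℂ) / q) := by rw [← sq, hsq]
  have hv2 : cexp (2 * π * I * ((k * p : ℤ) : ℂ) / q) * cexp (2 * π * I * ((-k : ℤ) : ℂ) / q) =
      cexp (2 * π * I * ((k * (p - 1) : ℤ) : ℂ) / q) := by
    rw [exp_intCast_mul_exp_intCast, show k * p + -k = k * (p - 1) by ring]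
  have hv3 : cexp (2 * π * I * ((-(k * p) : ℤ) : ℂ) / q) * cexp (2 * π * I * ((-k : ℤ) : ℂ) / q) =
      cexp (2 * π * I * ((-(k * (p + 1)) : ℤ) : ℂ) / q) := by
    rw [exp_intCast_mul_exp_intCast, show -(k * p) + -k = -(k * (p + 1)) by ring]
  -- none of the three remaining factors vanishes at `z₀`
  have hn1 : 1 - cexp (2 * π * I * ((-(2 * k) : ℤ) : ℂ) / q) ≠ 0 := by
    rw [sub_ne_zero, ne_comm, Ne, exp_intCast_eq_one_iff hq, dvd_neg]
    exact h2
  have hn2 : 1 - cexp (2 * π * I * ((k * (p - 1) : ℤ) : ℂ) / q) ≠ 0 := by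
    rw [sub_ne_zero, ne_comm, Ne, exp_intCast_eq_one_iff hq]
    exact hm
  have hn3 : 1 - cexp (2 * π * I * ((-(k * (p + 1)) : ℤ) : ℂ) / q) ≠ 0 := by
    rw [sub_ne_zero, ne_comm, Ne, exp_intCast_eq_one_iff hq, dvd_neg]
    exact hp
  have h := tendsto_mul_div_of_factor hγ
    (D := fun z ↦ (1 - cexp (2 * π * I * k / q) * z) * (1 - cexp (2 * π * I * ((-k : ℤ) : ℂ) / q) * z) *
      ((1 - cexp (2 * π * I * ((k * p : ℤ) : ℂ) / q) * z) * (1 - cexp (2 * π * I * ((-(k * p) : ℤ) : ℂ) / q) * z)))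
    (R := fun z ↦ (1 - cexp (2 * π * I * ((-k : ℤ) : ℂ) / q) * z) *
      ((1 - cexp (2 * π * I * ((k * p : ℤ) : ℂ) / q) * z) * (1 - cexp (2 * π * I * ((-(k * p) : ℤ) : ℂ) / q) * z)))
    (fun z ↦ by ring) (by fun_prop) (by
      show (1 - cexp (2 * π * I * ((-k : ℤ) : ℂ) / q) * cexp (2 * π * I * ((-k : ℤ) : ℂ) / q)) *
        ((1 - cexp (2 * π * I * ((k * p : ℤ) : ℂ) / q) * cexp (2 * π * I * ((-k : ℤ) : ℂ) / q)) *
          (1 - cexp (2 * π * I * ((-(k * p) : ℤ) : ℂ) / q) * cexp (2 * π * I * ((-k : ℤ) : ℂ) / q))) ≠ 0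
      rw [hv1, hv2, hv3]
      exact mul_ne_zero hn1 (mul_ne_zero hn2 hn3))
  have hval : (1 - cexp (2 * π * I * ((-k : ℤ) : ℂ) / q) ^ 2) /
      ((1 - cexp (2 * π * I * ((-k : ℤ) : ℂ) / q) * cexp (2 * π * I * ((-k : ℤ) : ℂ) / q)) *
        ((1 - cexp (2 * π * I * ((k * p : ℤ) : ℂ) / q) * cexp (2 * π * I * ((-k : ℤ) : ℂ) / q)) *
          (1 - cexp (2 * π * I * ((-(k * p) : ℤ) : ℂ) / q) * cexp (2 * π * I * ((-k : ℤ) : ℂ) / q)))) =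
      1 / ((1 - cexp (2 * π * I * ((k * (p - 1) : ℤ) : ℂ) / q)) *
        (1 - cexp (2 * π * I * ((-(k * (p + 1)) : ℤ) : ℂ) / q))) := by
    rw [hsq, hv1, hv2, hv3]
    field_simp
  rw [hval] at h
  exact h

/-- `pp* ≡ 1 (mod q)` in `ℤ/q`. [folklore] -/
private theorem cast_mul_cast_eq_one {q : ℕ} {p u : ℤ} (hu : (q : ℤ) ∣ u * p - 1) :
    (u : ZMod q) * (p : ZMod q) = 1 := by
  have h := (ZMod.intCast_zmod_eq_zero_iff_dvd (u * p - 1) q).mpr hu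
  push_cast at h
  exact sub_eq_zero.mp h

/-- "by multiplying (4.13) and (4.14) by `p₁*`, we have `(p₁* + 1)k ≢ 0` and `(p₁* − 1)k ≢ 0 (mod q)`".
[cite: IkedaYamamoto1979, proof of Proposition 4.6] -/
private theorem not_dvd_mul_inv_sub_one {q : ℕ} {k p u : ℤ} (hu : (q : ℤ) ∣ u * p - 1) (hm : ¬ (q : ℤ) ∣ k * (p - 1)) :
    ¬ (q : ℤ) ∣ k * (u - 1) := by
  intro h
  apply hm
  have h0 := (ZMod.intCast_zmod_eq_zero_iff_dvd (k * (u - 1)) q).mpr h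
  have h1 := cast_mul_cast_eq_one hu
  rw [← ZMod.intCast_zmod_eq_zero_iff_dvd]
  push_cast at h0 ⊢
  linear_combination (-(p : ZMod q)) * h0 + (k : ZMod q) * h1

/-- The companion for `(p₁* + 1)k`. [cite: IkedaYamamoto1979, proof of Proposition 4.6] -/
private theorem not_dvd_mul_inv_add_one {q : ℕ} {k p u : ℤ} (hu : (q : ℤ) ∣ u * p - 1) (hp : ¬ (q : ℤ) ∣ k * (p + 1)) :
    ¬ (q : ℤ) ∣ k * (u + 1) := by
  intro h
  apply hp
  have h0 := (ZMod.intCast_zmod_eq_zero_iff_dvd (k * (u + 1)) q).mpr h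
  have h1 := cast_mul_cast_eq_one hu
  rw [← ZMod.intCast_zmod_eq_zero_iff_dvd]
  push_cast at h0 ⊢
  linear_combination (p : ZMod q) * h0 - (k : ZMod q) * h1

/-- **The four special classes `k, −k, kp*, −kp*` of `ℤ/q` are pairwise distinct** under `q ∤ 2k`, `q ∤ k(p∓1)`.
[cite: IkedaYamamoto1979, proof of Proposition 4.6] -/
private theorem special_classes_distinct {q : ℕ} {k p u : ℤ} (hu : (q : ℤ) ∣ u * p - 1) (h2 : ¬ (q : ℤ) ∣ 2 * k)
    (hm : ¬ (q : ℤ) ∣ k * (p - 1)) (hp : ¬ (q : ℤ) ∣ k * (p + 1)) :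
    (k : ZMod q) ≠ -(k : ZMod q) ∧ (k : ZMod q) ≠ (k : ZMod q) * (u : ZMod q) ∧
      (k : ZMod q) ≠ -((k : ZMod q) * (u : ZMod q)) ∧ -(k : ZMod q) ≠ (k : ZMod q) * (u : ZMod q) ∧
      -(k : ZMod q) ≠ -((k : ZMod q) * (u : ZMod q)) ∧ (k : ZMod q) * (u : ZMod q) ≠ -((k : ZMod q) * (u : ZMod q)) := by
  have h1 := cast_mul_cast_eq_one hu
  have c2 : ((2 * k : ℤ) : ZMod q) ≠ 0 := fun h ↦ h2 ((ZMod.intCast_zmod_eq_zero_iff_dvd _ _).mp h)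
  have cm : ((k * (p - 1) : ℤ) : ZMod q) ≠ 0 := fun h ↦ hm ((ZMod.intCast_zmod_eq_zero_iff_dvd _ _).mp h)
  have cp : ((k * (p + 1) : ℤ) : ZMod q) ≠ 0 := fun h ↦ hp ((ZMod.intCast_zmod_eq_zero_iff_dvd _ _).mp h)
  push_cast at c2 cm cp
  refine ⟨fun h ↦ c2 ?_, fun h ↦ cm ?_, fun h ↦ cp ?_, fun h ↦ cp ?_, fun h ↦ cm ?_, fun h ↦ c2 ?_⟩
  · linear_combination h
  · linear_combination (p : ZMod q) * h + (k : ZMod q) * h1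
  · linear_combination (p : ZMod q) * h - (k : ZMod q) * h1
  · linear_combination (-(p : ZMod q)) * h - (k : ZMod q) * h1
  · linear_combination (-(p : ZMod q)) * h + (k : ZMod q) * h1
  · linear_combination (p : ZMod q) * h - (2 * k : ZMod q) * h1

/-- `∑_{x ∈ ℤ/q} F(x̃) = ∑_{l < q} F(l)` through the representatives `x̃ ∈ [0, q)`. [folklore] -/
private theorem sum_zmod_val_eq_sum_range' {M : Type*} [AddCommMonoid M] {q : ℕ} [NeZero q] (F : ℕ → M) :
    ∑ x : ZMod q, F x.val = ∑ l ∈ range q, F l := by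
  refine Finset.sum_nbij ZMod.val (fun x _ ↦ mem_range.2 (ZMod.val_lt x)) ?_ ?_ (fun _ _ ↦ rfl)
  · exact fun x _ y _ h ↦ ZMod.val_injective q h
  · intro n hn
    exact ⟨(n : ZMod q), by simp, ZMod.val_cast_of_lt (mem_range.1 hn)⟩

/-- The tree's `e^{±2πi·l·p/q}` of (3.8) as `e(t)`, `e(−t)` whenever `lp ≡ t (mod q)`. [folklore] -/
private theorem exp_natCast_mul_eq {q : ℕ} (hq : q ≠ 0) {l : ℕ} {p t : ℤ} (h : (l : ZMod q) * (p : ZMod q) = (t : ZMod q)) :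
    cexp (2 * π * I * l * p / q) = cexp (2 * π * I * t / q) ∧
      cexp (-(2 * π * I * l * p / q)) = cexp (2 * π * I * ((-t : ℤ) : ℂ) / q) := by
  have h' : (((l : ℤ) * p : ℤ) : ZMod q) = (t : ZMod q) := by
    rw [Int.cast_mul, Int.cast_natCast, h]
  refine ⟨?_, ?_⟩
  · rw [exp_natCast_mul_intCast]
    exact exp_intCast_congr hq h'
  · rw [exp_neg_natCast_mul_intCast]
    exact exp_intCast_congr hq (by rw [Int.cast_neg, Int.cast_neg, h'])

/-- `e^{2πi·l·p/q}·e(−k) = 1 ↔ lp ≡ k` and `e^{−2πi·l·p/q}·e(−k) = 1 ↔ −lp ≡ k (mod q)`: which factors of the `l`-th term vanish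
at `z₀ = e(−k)`. [folklore] -/
private theorem exp_natCast_mul_mul_eq_one_iff {q : ℕ} (hq : q ≠ 0) (l : ℕ) (p k : ℤ) :
    (cexp (2 * π * I * l * p / q) * cexp (2 * π * I * ((-k : ℤ) : ℂ) / q) = 1 ↔
      (l : ZMod q) * (p : ZMod q) = (k : ZMod q)) ∧
    (cexp (-(2 * π * I * l * p / q)) * cexp (2 * π * I * ((-k : ℤ) : ℂ) / q) = 1 ↔
      -((l : ZMod q) * (p : ZMod q)) = (k : ZMod q)) := by
  refine ⟨?_, ?_⟩
  · rw [exp_natCast_mul_intCast, exp_intCast_mul_exp_intCast, exp_intCast_eq_one_iff_cast hq]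
    push_cast
    rw [← sub_eq_add_neg, sub_eq_zero]
  · rw [exp_neg_natCast_mul_intCast, exp_intCast_mul_exp_intCast, exp_intCast_eq_one_iff_cast hq]
    push_cast
    rw [← sub_eq_add_neg, sub_eq_zero]

/-! ### §2 The terms of (3.8) for `L(q; 1, p)` at `z₀ = e(−k)`: four simple poles, the rest holomorphic -/

/-- **Case `l ≡ k`**: the term is `T(z)` of `tendsto_core`; limit `R(p)`. [cite: IkedaYamamoto1979, proof of Proposition 4.6] -/
private theorem tendsto_term_pos {q : ℕ} (hq : q ≠ 0) {k p : ℤ} (h2 : ¬ (q : ℤ) ∣ 2 * k) (hm : ¬ (q : ℤ) ∣ k * (p - 1))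
    (hp : ¬ (q : ℤ) ∣ k * (p + 1)) {l : ℕ} (hl : (l : ZMod q) = (k : ZMod q)) :
    Tendsto (fun z : ℂ ↦ (1 - cexp (2 * π * I * k / q) * z) * ((1 - z ^ 2) /
      ((1 - cexp (2 * π * I * l * ((1 : ℤ) : ℂ) / q) * z) * (1 - cexp (-(2 * π * I * l * ((1 : ℤ) : ℂ) / q)) * z) *
        ((1 - cexp (2 * π * I * l * (p : ℂ) / q) * z) * (1 - cexp (-(2 * π * I * l * (p : ℂ) / q)) * z)))))
      (𝓝[≠] (cexp (2 * π * I * ((-k : ℤ) : ℂ) / q)))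
      (𝓝 (1 / ((1 - cexp (2 * π * I * ((k * (p - 1) : ℤ) : ℂ) / q)) *
        (1 - cexp (2 * π * I * ((-(k * (p + 1)) : ℤ) : ℂ) / q))))) := by
  have h1 : (l : ZMod q) * ((1 : ℤ) : ZMod q) = (k : ZMod q) := by rw [hl]; push_cast; ring
  have h3 : (l : ZMod q) * (p : ZMod q) = ((k * p : ℤ) : ZMod q) := by rw [hl]; push_cast; ring
  obtain ⟨e1, e2⟩ := exp_natCast_mul_eq hq h1
  obtain ⟨e3, e4⟩ := exp_natCast_mul_eq hq h3
  simp only [e1, e2, e3, e4]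
  exact tendsto_core hq h2 hm hp

/-- **Case `l ≡ −k`**: the same function of `z` (the factors come in the pairs `e(±l)`, `e(±lp)`); limit `R(p)`.
[cite: IkedaYamamoto1979, proof of Proposition 4.6] -/
private theorem tendsto_term_neg {q : ℕ} (hq : q ≠ 0) {k p : ℤ} (h2 : ¬ (q : ℤ) ∣ 2 * k) (hm : ¬ (q : ℤ) ∣ k * (p - 1))
    (hp : ¬ (q : ℤ) ∣ k * (p + 1)) {l : ℕ} (hl : (l : ZMod q) = -(k : ZMod q)) :
    Tendsto (fun z : ℂ ↦ (1 - cexp (2 * π * I * k / q) * z) * ((1 - z ^ 2) /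
      ((1 - cexp (2 * π * I * l * ((1 : ℤ) : ℂ) / q) * z) * (1 - cexp (-(2 * π * I * l * ((1 : ℤ) : ℂ) / q)) * z) *
        ((1 - cexp (2 * π * I * l * (p : ℂ) / q) * z) * (1 - cexp (-(2 * π * I * l * (p : ℂ) / q)) * z)))))
      (𝓝[≠] (cexp (2 * π * I * ((-k : ℤ) : ℂ) / q)))
      (𝓝 (1 / ((1 - cexp (2 * π * I * ((k * (p - 1) : ℤ) : ℂ) / q)) *
        (1 - cexp (2 * π * I * ((-(k * (p + 1)) : ℤ) : ℂ) / q))))) := by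
  have h1 : (l : ZMod q) * ((1 : ℤ) : ZMod q) = ((-k : ℤ) : ZMod q) := by rw [hl]; push_cast; ring
  have h3 : (l : ZMod q) * (p : ZMod q) = ((-(k * p) : ℤ) : ZMod q) := by rw [hl]; push_cast; ring
  obtain ⟨e1, e2⟩ := exp_natCast_mul_eq hq h1
  obtain ⟨e3, e4⟩ := exp_natCast_mul_eq hq h3
  simp only [e1, e2, e3, e4, neg_neg]
  refine ((tendsto_core hq h2 hm hp).congr fun z ↦ ?_)
  ring

/-- **Case `l ≡ kp*`**: the term is `T(z)` for the weight `p*` (`e(±lp) = e(±k)`); limit `R(p*)`.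
[cite: IkedaYamamoto1979, proof of Proposition 4.6] -/
private theorem tendsto_term_pos_inv {q : ℕ} (hq : q ≠ 0) {k p u : ℤ} (hu : (q : ℤ) ∣ u * p - 1) (h2 : ¬ (q : ℤ) ∣ 2 * k)
    (hm : ¬ (q : ℤ) ∣ k * (p - 1)) (hp : ¬ (q : ℤ) ∣ k * (p + 1)) {l : ℕ}
    (hl : (l : ZMod q) = (k : ZMod q) * (u : ZMod q)) :
    Tendsto (fun z : ℂ ↦ (1 - cexp (2 * π * I * k / q) * z) * ((1 - z ^ 2) /
      ((1 - cexp (2 * π * I * l * ((1 : ℤ) : ℂ) / q) * z) * (1 - cexp (-(2 * π * I * l * ((1 : ℤ) : ℂ) / q)) * z) *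
        ((1 - cexp (2 * π * I * l * (p : ℂ) / q) * z) * (1 - cexp (-(2 * π * I * l * (p : ℂ) / q)) * z)))))
      (𝓝[≠] (cexp (2 * π * I * ((-k : ℤ) : ℂ) / q)))
      (𝓝 (1 / ((1 - cexp (2 * π * I * ((k * (u - 1) : ℤ) : ℂ) / q)) *
        (1 - cexp (2 * π * I * ((-(k * (u + 1)) : ℤ) : ℂ) / q))))) := by
  have hup := cast_mul_cast_eq_one hu
  have h1 : (l : ZMod q) * ((1 : ℤ) : ZMod q) = ((k * u : ℤ) : ZMod q) := by rw [hl]; push_cast; ring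
  have h3 : (l : ZMod q) * (p : ZMod q) = (k : ZMod q) := by
    rw [hl]; linear_combination (k : ZMod q) * hup
  obtain ⟨e1, e2⟩ := exp_natCast_mul_eq hq h1
  obtain ⟨e3, e4⟩ := exp_natCast_mul_eq hq h3
  simp only [e1, e2, e3, e4]
  refine ((tendsto_core hq h2 (not_dvd_mul_inv_sub_one hu hm) (not_dvd_mul_inv_add_one hu hp)).congr fun z ↦ ?_)
  ring

/-- **Case `l ≡ −kp*`**: the same function as the case `l ≡ kp*`; limit `R(p*)`. [cite: IkedaYamamoto1979, proof of Proposition 4.6] -/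
private theorem tendsto_term_neg_inv {q : ℕ} (hq : q ≠ 0) {k p u : ℤ} (hu : (q : ℤ) ∣ u * p - 1) (h2 : ¬ (q : ℤ) ∣ 2 * k)
    (hm : ¬ (q : ℤ) ∣ k * (p - 1)) (hp : ¬ (q : ℤ) ∣ k * (p + 1)) {l : ℕ}
    (hl : (l : ZMod q) = -((k : ZMod q) * (u : ZMod q))) :
    Tendsto (fun z : ℂ ↦ (1 - cexp (2 * π * I * k / q) * z) * ((1 - z ^ 2) /
      ((1 - cexp (2 * π * I * l * ((1 : ℤ) : ℂ) / q) * z) * (1 - cexp (-(2 * π * I * l * ((1 : ℤ) : ℂ) / q)) * z) *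
        ((1 - cexp (2 * π * I * l * (p : ℂ) / q) * z) * (1 - cexp (-(2 * π * I * l * (p : ℂ) / q)) * z)))))
      (𝓝[≠] (cexp (2 * π * I * ((-k : ℤ) : ℂ) / q)))
      (𝓝 (1 / ((1 - cexp (2 * π * I * ((k * (u - 1) : ℤ) : ℂ) / q)) *
        (1 - cexp (2 * π * I * ((-(k * (u + 1)) : ℤ) : ℂ) / q))))) := by
  have hup := cast_mul_cast_eq_one hu
  have h1 : (l : ZMod q) * ((1 : ℤ) : ZMod q) = ((-(k * u) : ℤ) : ZMod q) := by rw [hl]; push_cast; ring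
  have h3 : (l : ZMod q) * (p : ZMod q) = ((-k : ℤ) : ZMod q) := by
    rw [hl]; push_cast; linear_combination (-(k : ZMod q)) * hup
  obtain ⟨e1, e2⟩ := exp_natCast_mul_eq hq h1
  obtain ⟨e3, e4⟩ := exp_natCast_mul_eq hq h3
  simp only [e1, e2, e3, e4, neg_neg]
  refine ((tendsto_core hq h2 (not_dvd_mul_inv_sub_one hu hm) (not_dvd_mul_inv_add_one hu hp)).congr fun z ↦ ?_)
  ring

/-- **All other `l`**: no factor of the term vanishes at `z₀ = e(−k)`; limit `0`. [cite: IkedaYamamoto1979, proof of Proposition 4.6] -/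
private theorem tendsto_term_zero {q : ℕ} (hq : q ≠ 0) {k p u : ℤ} (hu : (q : ℤ) ∣ u * p - 1) {l : ℕ}
    (hA : (l : ZMod q) ≠ (k : ZMod q)) (hB : (l : ZMod q) ≠ -(k : ZMod q))
    (hC : (l : ZMod q) ≠ (k : ZMod q) * (u : ZMod q)) (hD : (l : ZMod q) ≠ -((k : ZMod q) * (u : ZMod q))) :
    Tendsto (fun z : ℂ ↦ (1 - cexp (2 * π * I * k / q) * z) * ((1 - z ^ 2) /
      ((1 - cexp (2 * π * I * l * ((1 : ℤ) : ℂ) / q) * z) * (1 - cexp (-(2 * π * I * l * ((1 : ℤ) : ℂ) / q)) * z) *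
        ((1 - cexp (2 * π * I * l * (p : ℂ) / q) * z) * (1 - cexp (-(2 * π * I * l * (p : ℂ) / q)) * z)))))
      (𝓝[≠] (cexp (2 * π * I * ((-k : ℤ) : ℂ) / q))) (𝓝 0) := by
  have hup := cast_mul_cast_eq_one hu
  have hγ : cexp (2 * π * I * k / q) * cexp (2 * π * I * ((-k : ℤ) : ℂ) / q) = 1 := by
    rw [exp_intCast_mul_exp_intCast, show k + -k = 0 by ring, Int.cast_zero, mul_zero, zero_div, Complex.exp_zero]
  obtain ⟨i1, i2⟩ := exp_natCast_mul_mul_eq_one_iff hq l 1 k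
  obtain ⟨i3, i4⟩ := exp_natCast_mul_mul_eq_one_iff hq l p k
  have f1 : 1 - cexp (2 * π * I * l * ((1 : ℤ) : ℂ) / q) * cexp (2 * π * I * ((-k : ℤ) : ℂ) / q) ≠ 0 := by
    rw [sub_ne_zero, ne_comm, Ne, i1]
    push_cast
    exact fun h ↦ hA (by linear_combination h)
  have f2 : 1 - cexp (-(2 * π * I * l * ((1 : ℤ) : ℂ) / q)) * cexp (2 * π * I * ((-k : ℤ) : ℂ) / q) ≠ 0 := by
    rw [sub_ne_zero, ne_comm, Ne, i2]
    push_cast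
    exact fun h ↦ hB (by linear_combination -h)
  have f3 : 1 - cexp (2 * π * I * l * (p : ℂ) / q) * cexp (2 * π * I * ((-k : ℤ) : ℂ) / q) ≠ 0 := by
    rw [sub_ne_zero, ne_comm, Ne, i3]
    exact fun h ↦ hC (by linear_combination (u : ZMod q) * h - (l : ZMod q) * hup)
  have f4 : 1 - cexp (-(2 * π * I * l * (p : ℂ) / q)) * cexp (2 * π * I * ((-k : ℤ) : ℂ) / q) ≠ 0 := by
    rw [sub_ne_zero, ne_comm, Ne, i4]
    exact fun h ↦ hD (by linear_combination (-(u : ZMod q)) * h - (l : ZMod q) * hup)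
  exact tendsto_mul_div_of_ne_zero hγ (by fun_prop) (mul_ne_zero (mul_ne_zero f1 f2) (mul_ne_zero f3 f4))

/-- **The `l`-th term of (3.8) for `L(q; 1, p)`, multiplied by `1 − e(k)z`, as `z → e(−k)`**: limit `R(p)` if `l ≡ ±k`, `R(p*)` if
`l ≡ ±kp*`, and `0` otherwise. [cite: IkedaYamamoto1979, proof of Proposition 4.6] -/
private theorem tendsto_term {q : ℕ} (hq : q ≠ 0) {k p u : ℤ} (hu : (q : ℤ) ∣ u * p - 1) (h2 : ¬ (q : ℤ) ∣ 2 * k)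
    (hm : ¬ (q : ℤ) ∣ k * (p - 1)) (hp : ¬ (q : ℤ) ∣ k * (p + 1)) (l : ℕ) :
    Tendsto (fun z : ℂ ↦ (1 - cexp (2 * π * I * k / q) * z) * ((1 - z ^ 2) /
      ((1 - cexp (2 * π * I * l * ((1 : ℤ) : ℂ) / q) * z) * (1 - cexp (-(2 * π * I * l * ((1 : ℤ) : ℂ) / q)) * z) *
        ((1 - cexp (2 * π * I * l * (p : ℂ) / q) * z) * (1 - cexp (-(2 * π * I * l * (p : ℂ) / q)) * z)))))
      (𝓝[≠] (cexp (2 * π * I * ((-k : ℤ) : ℂ) / q)))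
      (𝓝 (if (l : ZMod q) = (k : ZMod q) ∨ (l : ZMod q) = -(k : ZMod q) then
          1 / ((1 - cexp (2 * π * I * ((k * (p - 1) : ℤ) : ℂ) / q)) *
            (1 - cexp (2 * π * I * ((-(k * (p + 1)) : ℤ) : ℂ) / q)))
        else if (l : ZMod q) = (k : ZMod q) * (u : ZMod q) ∨ (l : ZMod q) = -((k : ZMod q) * (u : ZMod q)) then
          1 / ((1 - cexp (2 * π * I * ((k * (u - 1) : ℤ) : ℂ) / q)) *
            (1 - cexp (2 * π * I * ((-(k * (u + 1)) : ℤ) : ℂ) / q)))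
        else 0)) := by
  by_cases hA : (l : ZMod q) = (k : ZMod q)
  · rw [if_pos (Or.inl hA)]
    exact tendsto_term_pos hq h2 hm hp hA
  by_cases hB : (l : ZMod q) = -(k : ZMod q)
  · rw [if_pos (Or.inr hB)]
    exact tendsto_term_neg hq h2 hm hp hB
  rw [if_neg (not_or.mpr ⟨hA, hB⟩)]
  by_cases hC : (l : ZMod q) = (k : ZMod q) * (u : ZMod q)
  · rw [if_pos (Or.inl hC)]
    exact tendsto_term_pos_inv hq hu h2 hm hp hC
  by_cases hD : (l : ZMod q) = -((k : ZMod q) * (u : ZMod q))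
  · rw [if_pos (Or.inr hD)]
    exact tendsto_term_neg_inv hq hu h2 hm hp hD
  rw [if_neg (not_or.mpr ⟨hC, hD⟩)]
  exact tendsto_term_zero hq hu hA hB hC hD

/-- **Exactly four terms contribute**: summing the limits of `tendsto_term` over `l < q` gives `2R(p) + 2R(p*)` (the classes
`k, −k, kp*, −kp*` are distinct and each has exactly one representative in `[0, q)`). [cite: IkedaYamamoto1979, proof of
Proposition 4.6] -/
private theorem sum_range_ite_eq {q : ℕ} [NeZero q] {k p u : ℤ} (hu : (q : ℤ) ∣ u * p - 1) (h2 : ¬ (q : ℤ) ∣ 2 * k)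
    (hm : ¬ (q : ℤ) ∣ k * (p - 1)) (hp : ¬ (q : ℤ) ∣ k * (p + 1)) (X Y : ℂ) :
    ∑ l ∈ range q, (if (l : ZMod q) = (k : ZMod q) ∨ (l : ZMod q) = -(k : ZMod q) then X
      else if (l : ZMod q) = (k : ZMod q) * (u : ZMod q) ∨ (l : ZMod q) = -((k : ZMod q) * (u : ZMod q)) then Y else 0) =
      2 * X + 2 * Y := by
  obtain ⟨d1, d2, d3, d4, d5, d6⟩ := special_classes_distinct hu h2 hm hp
  have hre := sum_zmod_val_eq_sum_range' (q := q) (fun l : ℕ ↦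
    (if (l : ZMod q) = (k : ZMod q) ∨ (l : ZMod q) = -(k : ZMod q) then X
      else if (l : ZMod q) = (k : ZMod q) * (u : ZMod q) ∨ (l : ZMod q) = -((k : ZMod q) * (u : ZMod q)) then Y else 0))
  simp only [ZMod.natCast_zmod_val] at hre
  rw [← hre]
  have hpt : ∀ x : ZMod q, (if x = (k : ZMod q) ∨ x = -(k : ZMod q) then X
      else if x = (k : ZMod q) * (u : ZMod q) ∨ x = -((k : ZMod q) * (u : ZMod q)) then Y else 0) =
      (if x = (k : ZMod q) then X else 0) + (if x = -(k : ZMod q) then X else 0) +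
        (if x = (k : ZMod q) * (u : ZMod q) then Y else 0) + (if x = -((k : ZMod q) * (u : ZMod q)) then Y else 0) := by
    intro x
    by_cases h1 : x = (k : ZMod q)
    · rw [if_pos (Or.inl h1), if_pos h1, if_neg (fun h ↦ d1 (h1.symm.trans h)), if_neg (fun h ↦ d2 (h1.symm.trans h)),
        if_neg (fun h ↦ d3 (h1.symm.trans h))]
      ring
    by_cases h2' : x = -(k : ZMod q)
    · rw [if_pos (Or.inr h2'), if_neg h1, if_pos h2', if_neg (fun h ↦ d4 (h2'.symm.trans h)),
        if_neg (fun h ↦ d5 (h2'.symm.trans h))]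
      ring
    rw [if_neg (not_or.mpr ⟨h1, h2'⟩), if_neg h1, if_neg h2']
    by_cases h3 : x = (k : ZMod q) * (u : ZMod q)
    · rw [if_pos (Or.inl h3), if_pos h3, if_neg (fun h ↦ d6 (h3.symm.trans h))]
      ring
    by_cases h4 : x = -((k : ZMod q) * (u : ZMod q))
    · rw [if_pos (Or.inr h4), if_neg h3, if_pos h4]
      ring
    rw [if_neg (not_or.mpr ⟨h3, h4⟩), if_neg h3, if_neg h4]
    ring
  rw [Finset.sum_congr rfl fun x _ ↦ hpt x]
  simp only [Finset.sum_add_distrib, Finset.sum_ite_eq', Finset.mem_univ, if_true]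
  ring

/-- **PROPOSITION 4.6 in closed form**: `(1 − e(k)z)·(1/q)∑_{l<q} T_l(z) → (2/q)(R(p) + R(p*))` as `z → e(−k)`, `z ≠ e(−k)`.
[cite: IkedaYamamoto1979, Proposition 4.6 (proof)] -/
private theorem tendsto_one_sub_exp_mul_closedForm {q : ℕ} [NeZero q] {k p u : ℤ} (hu : (q : ℤ) ∣ u * p - 1)
    (h2 : ¬ (q : ℤ) ∣ 2 * k) (hm : ¬ (q : ℤ) ∣ k * (p - 1)) (hp : ¬ (q : ℤ) ∣ k * (p + 1)) :
    Tendsto (fun z : ℂ ↦ (1 - cexp (2 * π * I * k / q) * z) * (1 / (q : ℂ) * ∑ l ∈ range q, (1 - z ^ 2) /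
      ((1 - cexp (2 * π * I * l * ((1 : ℤ) : ℂ) / q) * z) * (1 - cexp (-(2 * π * I * l * ((1 : ℤ) : ℂ) / q)) * z) *
        ((1 - cexp (2 * π * I * l * (p : ℂ) / q) * z) * (1 - cexp (-(2 * π * I * l * (p : ℂ) / q)) * z)))))
      (𝓝[≠] (cexp (2 * π * I * ((-k : ℤ) : ℂ) / q)))
      (𝓝 (2 / (q : ℂ) * (1 / ((1 - cexp (2 * π * I * ((k * (p - 1) : ℤ) : ℂ) / q)) *
            (1 - cexp (2 * π * I * ((-(k * (p + 1)) : ℤ) : ℂ) / q))) +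
          1 / ((1 - cexp (2 * π * I * ((k * (u - 1) : ℤ) : ℂ) / q)) *
            (1 - cexp (2 * π * I * ((-(k * (u + 1)) : ℤ) : ℂ) / q)))))) := by
  have hq : q ≠ 0 := NeZero.ne q
  have h := tendsto_finsetSum (range q) fun l (_ : l ∈ range q) ↦ tendsto_term hq hu h2 hm hp l
  rw [sum_range_ite_eq hu h2 hm hp] at h
  have h' := h.const_mul (1 / (q : ℂ))
  rw [show ∀ X Y : ℂ, 1 / (q : ℂ) * (2 * X + 2 * Y) = 2 / (q : ℂ) * (X + Y) from fun X Y ↦ by ring] at h'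
  refine h'.congr fun z ↦ ?_
  simp only [Finset.mul_sum]
  exact Finset.sum_congr rfl fun l _ ↦ by ring

/-- `𝓝[ball 0 1] z₀ ≤ 𝓝[≠] z₀` and `𝓝[ball 0 1] z₀` is nontrivial, for `|z₀| = 1`. [folklore] -/
private theorem nhdsWithin_ball_le_and_neBot' {z₀ : ℂ} (hz₀ : ‖z₀‖ = 1) :
    𝓝[Metric.ball (0 : ℂ) 1] z₀ ≤ 𝓝[≠] z₀ ∧ (𝓝[Metric.ball (0 : ℂ) 1] z₀).NeBot := by
  refine ⟨nhdsWithin_mono _ fun z hz (h1 : z = z₀) ↦ ?_, mem_closure_iff_nhdsWithin_neBot.mp ?_⟩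
  · rw [h1, mem_ball_zero_iff, hz₀] at hz
    exact lt_irrefl _ hz
  · rw [closure_ball (0 : ℂ) one_ne_zero, Metric.mem_closedBall, dist_zero_right, hz₀]

/-! ### §3 PROPOSITION 4.6: the residue of `F(z) = ∑_n dim E_{n(n+2)}(L(q;1,p)) z^n` at the simple pole `e(−k)`, and (4.17) -/

/-- **PROPOSITION 4.6 (Ikeda–Yamamoto 1979), the residue computed.** Let `L(q; 1, p)` be a three-dimensional lens space,
`pp* ≡ 1 (mod q)`, and let `k` be an integer with `q ∤ 2k`, `q ∤ (p − 1)k`, `q ∤ (p + 1)k` ((4.13)–(4.14)). Then the generating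
function `F(z) = ∑_n dim E_{n(n+2)} z^n` has a simple pole at the `q`-th root of unity `z₀ = e(−k) = e^{−2πik/q}`, with
`(1 − e(k)z)·F(z) → (2/q)·(R(p) + R(p*))` as `z → z₀` inside the unit disc, where
`R(t) = 1/((1 − e(k(t−1)))(1 − e(−k(t+1))))` ("We calculate the residue of `F₁(z)` at `z = γ^k` …": exactly the four terms
`l ≡ ±k, ±kp*` of (3.8) contribute). [cite: IkedaYamamoto1979, Proposition 4.6 and its proof, Theorem 3.2 (3.8)] -/
theorem tendsto_one_sub_exp_mul_tsum_lensMultiplicity {q : ℕ} [NeZero q] {k p u : ℤ} (hu : (q : ℤ) ∣ u * p - 1)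
    (h2 : ¬ (q : ℤ) ∣ 2 * k) (hm : ¬ (q : ℤ) ∣ k * (p - 1)) (hp : ¬ (q : ℤ) ∣ k * (p + 1)) :
    Tendsto (fun z : ℂ ↦ (1 - cexp (2 * π * I * k / q) * z) * ∑' n : ℕ, (lensMultiplicity q 1 p n : ℂ) * z ^ n)
      (𝓝[Metric.ball 0 1] (cexp (2 * π * I * ((-k : ℤ) : ℂ) / q)))
      (𝓝 (2 / (q : ℂ) * (1 / ((1 - cexp (2 * π * I * ((k * (p - 1) : ℤ) : ℂ) / q)) *
            (1 - cexp (2 * π * I * ((-(k * (p + 1)) : ℤ) : ℂ) / q))) +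
          1 / ((1 - cexp (2 * π * I * ((k * (u - 1) : ℤ) : ℂ) / q)) *
            (1 - cexp (2 * π * I * ((-(k * (u + 1)) : ℤ) : ℂ) / q)))))) := by
  have hq : q ≠ 0 := NeZero.ne q
  obtain ⟨hle, _⟩ := nhdsWithin_ball_le_and_neBot' (norm_exp_intCast q (-k))
  refine ((tendsto_one_sub_exp_mul_closedForm hu h2 hm hp).mono_left hle).congr' ?_
  filter_upwards [self_mem_nhdsWithin] with z hz
  rw [tsum_lensMultiplicity_mul_pow q hq 1 p (mem_ball_zero_iff.mp hz)]

/-- **(4.17) (Ikeda–Yamamoto 1979, Proposition 4.6): two isospectral lens spaces `L(q; 1, p₁)`, `L(q; 1, p₂)` have the same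
residues** — if `dim E_{n(n+2)}` agree for all `n` then, for every `k` with `q ∤ 2k` and `q ∤ (pᵢ ± 1)k`,
`R(p₁) + R(p₁*) = R(p₂) + R(p₂*)` ("Since `F₁(z) = F₂(z)`, we have the similar result for `F₂(z)`. Now, we obtain (4.17).").
The hypotheses (4.15)–(4.16) on `p₂` are assumed here (Corollary 4.5 of the source derives them from (4.13)–(4.14) via Lemma
4.4; for prime `q` they hold as soon as `p₂ ≢ ±1`). [cite: IkedaYamamoto1979, Proposition 4.6 (4.17), Proposition 3.1] -/
theorem residue_eq_of_lensMultiplicity_eq {q : ℕ} [NeZero q] {k p₁ u₁ p₂ u₂ : ℤ} (hu₁ : (q : ℤ) ∣ u₁ * p₁ - 1)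
    (hu₂ : (q : ℤ) ∣ u₂ * p₂ - 1) (h2 : ¬ (q : ℤ) ∣ 2 * k) (hm₁ : ¬ (q : ℤ) ∣ k * (p₁ - 1)) (hp₁ : ¬ (q : ℤ) ∣ k * (p₁ + 1))
    (hm₂ : ¬ (q : ℤ) ∣ k * (p₂ - 1)) (hp₂ : ¬ (q : ℤ) ∣ k * (p₂ + 1))
    (h : ∀ n : ℕ, lensMultiplicity q 1 p₁ n = lensMultiplicity q 1 p₂ n) :
    1 / ((1 - cexp (2 * π * I * ((k * (p₁ - 1) : ℤ) : ℂ) / q)) * (1 - cexp (2 * π * I * ((-(k * (p₁ + 1)) : ℤ) : ℂ) / q))) +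
      1 / ((1 - cexp (2 * π * I * ((k * (u₁ - 1) : ℤ) : ℂ) / q)) * (1 - cexp (2 * π * I * ((-(k * (u₁ + 1)) : ℤ) : ℂ) / q))) =
    1 / ((1 - cexp (2 * π * I * ((k * (p₂ - 1) : ℤ) : ℂ) / q)) * (1 - cexp (2 * π * I * ((-(k * (p₂ + 1)) : ℤ) : ℂ) / q))) +
      1 / ((1 - cexp (2 * π * I * ((k * (u₂ - 1) : ℤ) : ℂ) / q)) * (1 - cexp (2 * π * I * ((-(k * (u₂ + 1)) : ℤ) : ℂ) / q))) := by
  have hq : (q : ℂ) ≠ 0 := Nat.cast_ne_zero.mpr (NeZero.ne q)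
  have t1 := tendsto_one_sub_exp_mul_tsum_lensMultiplicity hu₁ h2 hm₁ hp₁
  have t2 := tendsto_one_sub_exp_mul_tsum_lensMultiplicity hu₂ h2 hm₂ hp₂
  simp only [h] at t1
  haveI := (nhdsWithin_ball_le_and_neBot' (norm_exp_intCast q (-k))).2
  exact mul_left_cancel₀ (div_ne_zero two_ne_zero hq) (tendsto_nhds_unique t1 t2)

/-! ### §4 COROLLARY 4.7: the cotangent form — `c(t) = (1 + e(t))/(1 − e(t)) = i·cot(πt/q)` and the relation (4.18) -/

/-- **`i·cot(πt/q) = (1 + e(t))/(1 − e(t))`** for every integer `t` (both sides vanish when `q ∣ t`, by the conventions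
`cot(πm) = 0`, `x/0 = 0`). [cite: IkedaYamamoto1979, proof of Corollary 4.7 ("an elementary formula")] -/
theorem I_mul_cot_eq_ratio (q : ℕ) (t : ℤ) :
    I * Complex.cot (π * t / q) = (1 + cexp (2 * π * I * t / q)) / (1 - cexp (2 * π * I * t / q)) := by
  rw [show (π : ℂ) * t / q = π * (t / q) by ring, Complex.cot_pi_eq_exp_ratio,
    show 2 * (π : ℂ) * I * (t / q) = 2 * π * I * t / q by ring]
  rcases eq_or_ne (1 - cexp (2 * π * I * t / q)) 0 with h | h
  · rw [h, mul_zero, div_zero, div_zero, mul_zero]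
  · rw [mul_div_assoc', div_eq_div_iff (mul_ne_zero I_ne_zero h) h]
    ring

/-- **The elementary formula** behind Corollary 4.7, in the `c`-form: for `q ∤ a`, `q ∤ b`, `q ∤ a − b`,
`c(a)c(b) = 1 − c(a − b)(c(a) − c(b))` (i.e. `cot α cot β = cot(α − β)(cot β − cot α) − 1` with `α = πa/q`, `β = πb/q`).
[cite: IkedaYamamoto1979, proof of Corollary 4.7] -/
theorem ratio_mul_ratio {q : ℕ} (hq : q ≠ 0) {a b : ℤ} (ha : ¬ (q : ℤ) ∣ a) (hb : ¬ (q : ℤ) ∣ b) (hab : ¬ (q : ℤ) ∣ a - b) :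
    (1 + cexp (2 * π * I * a / q)) / (1 - cexp (2 * π * I * a / q)) *
        ((1 + cexp (2 * π * I * b / q)) / (1 - cexp (2 * π * I * b / q))) =
      1 - (1 + cexp (2 * π * I * ((a - b : ℤ) : ℂ) / q)) / (1 - cexp (2 * π * I * ((a - b : ℤ) : ℂ) / q)) *
        ((1 + cexp (2 * π * I * a / q)) / (1 - cexp (2 * π * I * a / q)) -
          (1 + cexp (2 * π * I * b / q)) / (1 - cexp (2 * π * I * b / q))) := by
  have hab' : cexp (2 * π * I * a / q) = cexp (2 * π * I * ((a - b : ℤ) : ℂ) / q) * cexp (2 * π * I * b / q) := by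
    rw [exp_intCast_mul_exp_intCast, show a - b + b = a by ring]
  have h1 : 1 - cexp (2 * π * I * ((a - b : ℤ) : ℂ) / q) ≠ 0 := by
    rw [sub_ne_zero, ne_comm, Ne, exp_intCast_eq_one_iff hq]; exact hab
  have h2 : 1 - cexp (2 * π * I * b / q) ≠ 0 := by
    rw [sub_ne_zero, ne_comm, Ne, exp_intCast_eq_one_iff hq]; exact hb
  have h3 : 1 - cexp (2 * π * I * ((a - b : ℤ) : ℂ) / q) * cexp (2 * π * I * b / q) ≠ 0 := by
    rw [← hab', sub_ne_zero, ne_comm, Ne, exp_intCast_eq_one_iff hq]; exact ha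
  rw [hab']
  field_simp
  ring

/-- **Each residue term in the `c`-form**: for `q ∤ 2k`, `q ∤ k(p−1)`, `q ∤ k(p+1)`,
`R(p) = 1/((1 − e(k(p−1)))(1 − e(−k(p+1)))) = (c(k(p+1)) − c(k(p−1)))·(c(2k) − 1)/4` (from `1/(1 − e(t)) = (1 + c(t))/2`,
`1/(1 − e(−t)) = (1 − c(t))/2` and the elementary formula with `a − b = 2k`). [cite: IkedaYamamoto1979, proof of Corollary 4.7] -/
theorem residue_eq_ratio {q : ℕ} (hq : q ≠ 0) {k p : ℤ} (h2 : ¬ (q : ℤ) ∣ 2 * k) (hm : ¬ (q : ℤ) ∣ k * (p - 1))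
    (hp : ¬ (q : ℤ) ∣ k * (p + 1)) :
    1 / ((1 - cexp (2 * π * I * ((k * (p - 1) : ℤ) : ℂ) / q)) * (1 - cexp (2 * π * I * ((-(k * (p + 1)) : ℤ) : ℂ) / q))) =
      ((1 + cexp (2 * π * I * ((k * (p + 1) : ℤ) : ℂ) / q)) / (1 - cexp (2 * π * I * ((k * (p + 1) : ℤ) : ℂ) / q)) -
        (1 + cexp (2 * π * I * ((k * (p - 1) : ℤ) : ℂ) / q)) / (1 - cexp (2 * π * I * ((k * (p - 1) : ℤ) : ℂ) / q))) *
      ((1 + cexp (2 * π * I * ((2 * k : ℤ) : ℂ) / q)) / (1 - cexp (2 * π * I * ((2 * k : ℤ) : ℂ) / q)) - 1) / 4 := by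
  -- `a = e(k(p+1)) = b·w`, `b = e(k(p−1))`, `w = e(2k)`, `e(−k(p+1)) = a⁻¹`
  have hab : cexp (2 * π * I * ((k * (p + 1) : ℤ) : ℂ) / q) =
      cexp (2 * π * I * ((k * (p - 1) : ℤ) : ℂ) / q) * cexp (2 * π * I * ((2 * k : ℤ) : ℂ) / q) := by
    rw [exp_intCast_mul_exp_intCast, show k * (p - 1) + 2 * k = k * (p + 1) by ring]
  have hinv : cexp (2 * π * I * ((-(k * (p + 1)) : ℤ) : ℂ) / q) =
      (cexp (2 * π * I * ((k * (p - 1) : ℤ) : ℂ) / q) * cexp (2 * π * I * ((2 * k : ℤ) : ℂ) / q))⁻¹ := by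
    rw [← hab, ← Complex.exp_neg]
    congr 1
    push_cast
    ring
  have hb : 1 - cexp (2 * π * I * ((k * (p - 1) : ℤ) : ℂ) / q) ≠ 0 := by
    rw [sub_ne_zero, ne_comm, Ne, exp_intCast_eq_one_iff hq]; exact hm
  have hw : 1 - cexp (2 * π * I * ((2 * k : ℤ) : ℂ) / q) ≠ 0 := by
    rw [sub_ne_zero, ne_comm, Ne, exp_intCast_eq_one_iff hq]; exact h2
  have ha : 1 - cexp (2 * π * I * ((k * (p - 1) : ℤ) : ℂ) / q) * cexp (2 * π * I * ((2 * k : ℤ) : ℂ) / q) ≠ 0 := by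
    rw [← hab, sub_ne_zero, ne_comm, Ne, exp_intCast_eq_one_iff hq]; exact hp
  have hb0 : cexp (2 * π * I * ((k * (p - 1) : ℤ) : ℂ) / q) ≠ 0 := Complex.exp_ne_zero _
  have hw0 : cexp (2 * π * I * ((2 * k : ℤ) : ℂ) / q) ≠ 0 := Complex.exp_ne_zero _
  have ha' : cexp (2 * π * I * ((k * (p - 1) : ℤ) : ℂ) / q) * cexp (2 * π * I * ((2 * k : ℤ) : ℂ) / q) - 1 ≠ 0 := by
    rw [sub_ne_zero, ne_comm]
    exact fun h ↦ ha (sub_eq_zero.mpr h)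
  rw [hinv, hab]
  field_simp
  ring

/-- `c(2k) − 1 = 2e(2k)/(1 − e(2k)) ≠ 0` for `q ∤ 2k`. [folklore] -/
private theorem ratio_sub_one_ne_zero {q : ℕ} (hq : q ≠ 0) {k : ℤ} (h2 : ¬ (q : ℤ) ∣ 2 * k) :
    (1 + cexp (2 * π * I * ((2 * k : ℤ) : ℂ) / q)) / (1 - cexp (2 * π * I * ((2 * k : ℤ) : ℂ) / q)) - 1 ≠ 0 := by
  have hw : 1 - cexp (2 * π * I * ((2 * k : ℤ) : ℂ) / q) ≠ 0 := by
    rw [sub_ne_zero, ne_comm, Ne, exp_intCast_eq_one_iff hq]; exact h2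
  rw [show (1 + cexp (2 * π * I * ((2 * k : ℤ) : ℂ) / q)) / (1 - cexp (2 * π * I * ((2 * k : ℤ) : ℂ) / q)) - 1 =
    2 * cexp (2 * π * I * ((2 * k : ℤ) : ℂ) / q) / (1 - cexp (2 * π * I * ((2 * k : ℤ) : ℂ) / q)) by field_simp; ring]
  exact div_ne_zero (mul_ne_zero two_ne_zero (Complex.exp_ne_zero _)) hw

/-- **(4.18) in the `c`-form**: for isospectral `L(q; 1, p₁)`, `L(q; 1, p₂)` and `k` as in (4.13)–(4.16), with
`c(t) = (1 + e(t))/(1 − e(t))`: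
`c(k(p₁+1)) − c(k(p₁−1)) + c(k(p₁*+1)) − c(k(p₁*−1)) = c(k(p₂+1)) − c(k(p₂−1)) + c(k(p₂*+1)) − c(k(p₂*−1))`
(the common non-zero factor `(c(2k) − 1)/4` of (4.17) cancelled). [cite: IkedaYamamoto1979, Corollary 4.7 (proof)] -/
theorem ratio_alternatingSum_eq_of_lensMultiplicity_eq {q : ℕ} [NeZero q] {k p₁ u₁ p₂ u₂ : ℤ} (hu₁ : (q : ℤ) ∣ u₁ * p₁ - 1)
    (hu₂ : (q : ℤ) ∣ u₂ * p₂ - 1) (h2 : ¬ (q : ℤ) ∣ 2 * k) (hm₁ : ¬ (q : ℤ) ∣ k * (p₁ - 1)) (hp₁ : ¬ (q : ℤ) ∣ k * (p₁ + 1))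
    (hm₂ : ¬ (q : ℤ) ∣ k * (p₂ - 1)) (hp₂ : ¬ (q : ℤ) ∣ k * (p₂ + 1))
    (h : ∀ n : ℕ, lensMultiplicity q 1 p₁ n = lensMultiplicity q 1 p₂ n) :
    (1 + cexp (2 * π * I * ((k * (p₁ + 1) : ℤ) : ℂ) / q)) / (1 - cexp (2 * π * I * ((k * (p₁ + 1) : ℤ) : ℂ) / q)) -
        (1 + cexp (2 * π * I * ((k * (p₁ - 1) : ℤ) : ℂ) / q)) / (1 - cexp (2 * π * I * ((k * (p₁ - 1) : ℤ) : ℂ) / q)) +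
      ((1 + cexp (2 * π * I * ((k * (u₁ + 1) : ℤ) : ℂ) / q)) / (1 - cexp (2 * π * I * ((k * (u₁ + 1) : ℤ) : ℂ) / q)) -
        (1 + cexp (2 * π * I * ((k * (u₁ - 1) : ℤ) : ℂ) / q)) / (1 - cexp (2 * π * I * ((k * (u₁ - 1) : ℤ) : ℂ) / q))) =
    (1 + cexp (2 * π * I * ((k * (p₂ + 1) : ℤ) : ℂ) / q)) / (1 - cexp (2 * π * I * ((k * (p₂ + 1) : ℤ) : ℂ) / q)) -
        (1 + cexp (2 * π * I * ((k * (p₂ - 1) : ℤ) : ℂ) / q)) / (1 - cexp (2 * π * I * ((k * (p₂ - 1) : ℤ) : ℂ) / q)) +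
      ((1 + cexp (2 * π * I * ((k * (u₂ + 1) : ℤ) : ℂ) / q)) / (1 - cexp (2 * π * I * ((k * (u₂ + 1) : ℤ) : ℂ) / q)) -
        (1 + cexp (2 * π * I * ((k * (u₂ - 1) : ℤ) : ℂ) / q)) / (1 - cexp (2 * π * I * ((k * (u₂ - 1) : ℤ) : ℂ) / q))) := by
  have hq : q ≠ 0 := NeZero.ne q
  have e := residue_eq_of_lensMultiplicity_eq hu₁ hu₂ h2 hm₁ hp₁ hm₂ hp₂ h
  rw [residue_eq_ratio hq h2 hm₁ hp₁, residue_eq_ratio hq h2 hm₂ hp₂,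
    residue_eq_ratio hq h2 (not_dvd_mul_inv_sub_one hu₁ hm₁) (not_dvd_mul_inv_add_one hu₁ hp₁),
    residue_eq_ratio hq h2 (not_dvd_mul_inv_sub_one hu₂ hm₂) (not_dvd_mul_inv_add_one hu₂ hp₂)] at e
  have hc := ratio_sub_one_ne_zero hq h2
  have e' := sub_eq_zero.mpr e
  rw [← sub_eq_zero]
  refine (mul_eq_zero.mp ?_).resolve_right hc
  linear_combination 4 * e'

/-- **COROLLARY 4.7 (Ikeda–Yamamoto 1979), the relation (4.18) as printed.** Let `L(q; 1, p₁)` and `L(q; 1, p₂)` be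
isospectral three-dimensional lens spaces (`dim E_{n(n+2)}` agree for all `n`), `pᵢpᵢ* ≡ 1 (mod q)`, and let `k` be an
integer with `q ∤ 2k` and `(pᵢ ± 1)k ≢ 0 (mod q)` ((4.13)–(4.16)). Then
`cot(π(p₁+1)k/q) − cot(π(p₁−1)k/q) + cot(π(p₁*+1)k/q) − cot(π(p₁*−1)k/q)`
`= cot(π(p₂+1)k/q) − cot(π(p₂−1)k/q) + cot(π(p₂*+1)k/q) − cot(π(p₂*−1)k/q)`, i.e. (4.18).
[cite: IkedaYamamoto1979, Corollary 4.7 (4.18)] -/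
theorem cot_alternatingSum_eq_of_lensMultiplicity_eq {q : ℕ} [NeZero q] {k p₁ u₁ p₂ u₂ : ℤ} (hu₁ : (q : ℤ) ∣ u₁ * p₁ - 1)
    (hu₂ : (q : ℤ) ∣ u₂ * p₂ - 1) (h2 : ¬ (q : ℤ) ∣ 2 * k) (hm₁ : ¬ (q : ℤ) ∣ k * (p₁ - 1)) (hp₁ : ¬ (q : ℤ) ∣ k * (p₁ + 1))
    (hm₂ : ¬ (q : ℤ) ∣ k * (p₂ - 1)) (hp₂ : ¬ (q : ℤ) ∣ k * (p₂ + 1))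
    (h : ∀ n : ℕ, lensMultiplicity q 1 p₁ n = lensMultiplicity q 1 p₂ n) :
    Complex.cot (π * ((k * (p₁ + 1) : ℤ) : ℂ) / q) - Complex.cot (π * ((k * (p₁ - 1) : ℤ) : ℂ) / q) +
        (Complex.cot (π * ((k * (u₁ + 1) : ℤ) : ℂ) / q) - Complex.cot (π * ((k * (u₁ - 1) : ℤ) : ℂ) / q)) =
      Complex.cot (π * ((k * (p₂ + 1) : ℤ) : ℂ) / q) - Complex.cot (π * ((k * (p₂ - 1) : ℤ) : ℂ) / q) +
        (Complex.cot (π * ((k * (u₂ + 1) : ℤ) : ℂ) / q) - Complex.cot (π * ((k * (u₂ - 1) : ℤ) : ℂ) / q)) := by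
  have e := ratio_alternatingSum_eq_of_lensMultiplicity_eq hu₁ hu₂ h2 hm₁ hp₁ hm₂ hp₂ h
  simp only [← I_mul_cot_eq_ratio] at e
  exact mul_left_cancel₀ I_ne_zero (by linear_combination e)

end Literature.Analysis.InnerProduct
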